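import Mathlib
import HarnessLib
import Summits.NavierStokesRegularity.NavierStokesRegularity.Theorems.UnthreadedDoorNetFluxNearCentreComparison
import Summits.NavierStokesRegularity.NavierStokesRegularity.Theorems.UnthreadedDoorNetFluxEnvelopeDefect

/-!
# Route `UnthreadedDoor`, crux `PoloidalLiouville` (stmt-NavierStokesRegularity-1222), WALL W1 `stub_scalarLiouville` —
# crux idea «netflux-typei-gap» (ns-idea-14, LINE v5): stub NF-6 `NearCentreFlux`, part 2 — JOINT REGULARITY AND ASSEMBLY

KEY-NS #156/#157 (director-ns g16; author ns-idea-14, «NETFLUX LINE v5» bcd4955f0879).  `NetFlux.NearCentreFlux` (Lines file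
`Cruxes/PoloidalLiouville/Lines/netflux_typei_gap.lean`, §0 (NC)): for `v` smooth on the window `]t₀,0[ × ℝ³`, `T` smooth off the
centre, `curl v(t) = ∇T(t) × (x − x₀)`, and `t₀ < t₁ ≤ t₂ < 0`, there is `κ ≥ 0` such that for every `a₀ ∈ ]0,1]`:
(a) `w(t,a) ≤ κ a²` for `t ∈ [t₁,t₂]`, `a ∈ ]0,a₀[`; (b) `w(t,·)` is `κa₀`-Lipschitz on `]0,a₀[`; (c) `|w(t,a) − w(t',a)| ≤ κ a² |t − t'|`
— where `w(t,a) = netFlux (T t) x₀ a = a · osc_{S_a(x₀)} T(t)`.  PROOF: `ω̂(t,x) = curl v(t)(x) = curlCLM(D_x v)` is jointly smooth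
(slice calculus, p664045), `ω̂(t,x₀) = 0`; `L = sup ‖D_x ω̂‖` and `M = sup ‖D_x ∂_t ω̂‖` over `[t₁,t₂] × B̄(x₀,1)` give
`‖ω̂(t,y) − ω̂(t',y)‖ ≤ M ‖y − x₀‖ |t − t'|` (two mean value inequalities, `∂_tω̂(t,x₀) = 0`); then (a) is the growth cap
`netFlux_le_sq` (p664588), (b) is `osc ≤ πLa` plus the two-radius comparison `|osc_ρ − osc_ρ'| ≤ πL|ρ − ρ'|`, and (c) is the
two-field comparison with `K = M a |t − t'|` (both from part 1, `UnthreadedDoorNetFluxNearCentreComparison`); `κ = π(2L + M)`.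

* `contDiff_slice_of_window`, `contDiffOn_curl_family` — per-time and joint smoothness of `v`, `curl v`;
* `exists_bound_fderiv_curl` — the constant `L`;  `exists_bound_curl_sub_curl` — the constant `M` and the time-Lipschitz bound;
* `nearCentreFlux` — **the statement of `NetFlux.NearCentreFlux` (verbatim body), proved**: closes `stub_nearCentreFlux` (NF-6) of
  the line BY NAME (definitional unfolding of the line's twins).

WHAT THIS IS NOT: no NS-regularity statement is touched (pure kinematics of a toroidal representation); `PoloidalLiouville` (1222),
W1, the line's rung target `TypeI_Liouville_noswirl` and the summit stay OPEN.  `--supports stmt-NavierStokesRegularity-1222 --as helper`.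
[folklore]
-/

noncomputable section

-- the summit and its single sub-problem share the name (CONVENTIONS §1)
set_option linter.dupNamespace false

open Set Function Filter Topology InnerProductSpace MeasureTheory
open scoped RealInnerProductSpace ContDiff

namespace Summit.NavierStokesRegularity.NavierStokesRegularity.Theorems.PoloidalLiouville.NetFlux

open Literature.Analysis Literature.Analysis.FluidPDE

variable {v : ℝ → E3 → E3} {T : ℝ → E3 → ℝ} {x₀ : E3} {t₀ t₁ t₂ : ℝ}

/-! ### Joint regularity of the vorticity of a space-time smooth field -/

/-- Time slices of a field smooth on the window `]t₀,0[ × ℝ³` are smooth. [folklore] -/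
theorem contDiff_slice_of_window (hv : ContDiffOn ℝ (⊤ : ℕ∞) (uncurry v) (Ioo t₀ 0 ×ˢ (univ : Set E3))) {t : ℝ}
    (ht : t ∈ Ioo t₀ 0) : ContDiff ℝ (⊤ : ℕ∞) (v t) := by
  have h : ContDiffOn ℝ (⊤ : ℕ∞) (uncurry v ∘ fun x : E3 => (t, x)) univ :=
    hv.comp (contDiffOn_const.prodMk contDiffOn_id) fun x _ => ⟨ht, mem_univ _⟩
  exact contDiffOn_univ.1 h

/-- **The space-time vorticity `(t,x) ↦ curl v(t)(x)` of a field smooth on the window is smooth on the window**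
(`curl = curlCLM ∘ D_x`, spatial slice derivatives of a jointly smooth function are jointly smooth). [folklore] -/
theorem contDiffOn_curl_family (hv : ContDiffOn ℝ (⊤ : ℕ∞) (uncurry v) (Ioo t₀ 0 ×ˢ (univ : Set E3))) :
    ContDiffOn ℝ (⊤ : ℕ∞) (fun q : ℝ × E3 => curl (v q.1) q.2) (Ioo t₀ 0 ×ˢ (univ : Set E3)) := by
  have hW : IsOpen (Ioo t₀ 0 ×ˢ (univ : Set E3)) := isOpen_Ioo.prod isOpen_univ
  have h := (contDiffOn_fderiv_xslice hW hv).2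
  have e : (fun q : ℝ × E3 => curl (v q.1) q.2) =
      fun q => curlCLM (fderiv ℝ (fun y => uncurry v (q.1, y)) q.2) := rfl
  rw [e]
  exact curlCLM.contDiff.comp_contDiffOn h

/-- **The constant `L`**: a bound of `‖D(curl v(t))(x)‖` over `[t₁,t₂] × B̄(x₀,1)`, `t₀ < t₁`, `t₂ < 0`. [folklore] -/
theorem exists_bound_fderiv_curl (x₀ : E3) (hv : ContDiffOn ℝ (⊤ : ℕ∞) (uncurry v) (Ioo t₀ 0 ×ˢ (univ : Set E3)))
    (h₁ : t₀ < t₁) (h₂ : t₂ < 0) :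
    ∃ L : ℝ, 0 ≤ L ∧ ∀ t ∈ Icc t₁ t₂, ∀ x ∈ Metric.closedBall x₀ 1, ‖fderiv ℝ (curl (v t)) x‖ ≤ L := by
  have hW : IsOpen (Ioo t₀ 0 ×ˢ (univ : Set E3)) := isOpen_Ioo.prod isOpen_univ
  have hD := (contDiffOn_fderiv_xslice hW (contDiffOn_curl_family hv)).2
  have hK : IsCompact (Icc t₁ t₂ ×ˢ Metric.closedBall x₀ 1) := isCompact_Icc.prod (isCompact_closedBall _ _)
  have hKW : Icc t₁ t₂ ×ˢ Metric.closedBall x₀ 1 ⊆ Ioo t₀ 0 ×ˢ (univ : Set E3) := fun q hq =>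
    ⟨⟨h₁.trans_le hq.1.1, lt_of_le_of_lt hq.1.2 h₂⟩, mem_univ _⟩
  obtain ⟨L, hL⟩ := hK.exists_bound_of_continuousOn (hD.continuousOn.mono hKW)
  exact ⟨max L 0, le_max_right _ _, fun t ht x hx => (hL (t, x) ⟨ht, hx⟩).trans (le_max_left _ _)⟩

/-- **The constant `M` and the time-Lipschitz bound of the vorticity near the centre**: for `v` smooth on the window with
`curl v(t) = ∇T(t) × (x − x₀)` (so `curl v(t)(x₀) = 0` and `∂_t curl v(t)(x₀) = 0`), there is `M ≥ 0` with
`‖curl v(t)(y) − curl v(t')(y)‖ ≤ M ‖y − x₀‖ |t − t'|` for `t, t' ∈ [t₁,t₂]`, `y ∈ B̄(x₀,1)` (mean value in `x` for `∂_t curl v`, then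
in `t`). [folklore] -/
theorem exists_bound_curl_sub_curl (hv : ContDiffOn ℝ (⊤ : ℕ∞) (uncurry v) (Ioo t₀ 0 ×ˢ (univ : Set E3)))
    (hrep : ∀ t ∈ Ioo t₀ 0, ∀ x, curl (v t) x = cross (gradient (T t) x) (x - x₀)) (h₁ : t₀ < t₁) (h₂ : t₂ < 0) :
    ∃ M : ℝ, 0 ≤ M ∧ ∀ t ∈ Icc t₁ t₂, ∀ t' ∈ Icc t₁ t₂, ∀ y ∈ Metric.closedBall x₀ 1,
      ‖curl (v t) y - curl (v t') y‖ ≤ M * ‖y - x₀‖ * |t - t'| := by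
  set W : Set (ℝ × E3) := Ioo t₀ 0 ×ˢ (univ : Set E3) with hWdef
  have hW : IsOpen W := isOpen_Ioo.prod isOpen_univ
  set Om : ℝ × E3 → E3 := fun q => curl (v q.1) q.2 with hOmdef
  have hOm : ContDiffOn ℝ (⊤ : ℕ∞) Om W := contDiffOn_curl_family hv
  set Om₁ : ℝ × E3 → E3 := fun q => deriv (fun s => Om (s, q.2)) q.1 with hOm₁def
  have hOm₁ : ContDiffOn ℝ (⊤ : ℕ∞) Om₁ W := (contDiffOn_deriv_tslice hW hOm).2
  have hOm₁x : ContDiffOn ℝ (⊤ : ℕ∞) (fun q : ℝ × E3 => fderiv ℝ (fun y => Om₁ (q.1, y)) q.2) W :=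
    (contDiffOn_fderiv_xslice hW hOm₁).2
  -- the constant `M`
  have hK : IsCompact (Icc t₁ t₂ ×ˢ Metric.closedBall x₀ 1) := isCompact_Icc.prod (isCompact_closedBall _ _)
  have hIcc : Icc t₁ t₂ ⊆ Ioo t₀ 0 := fun s hs => ⟨h₁.trans_le hs.1, lt_of_le_of_lt hs.2 h₂⟩
  have hKW : Icc t₁ t₂ ×ˢ Metric.closedBall x₀ 1 ⊆ W := fun q hq => ⟨hIcc hq.1, mem_univ _⟩
  obtain ⟨M₀, hM₀⟩ := hK.exists_bound_of_continuousOn (hOm₁x.continuousOn.mono hKW)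
  set M : ℝ := max M₀ 0 with hM
  have hM0 : 0 ≤ M := le_max_right _ _
  -- `Om(s, x₀) = 0` on the window, hence `Om₁(s, x₀) = 0`
  have hOm0 : ∀ s ∈ Ioo t₀ 0, Om (s, x₀) = 0 := fun s hs => cross_gradient_self_center (hrep s hs)
  have hOm₁0 : ∀ s ∈ Ioo t₀ 0, Om₁ (s, x₀) = 0 := by
    intro s hs
    have hev : (fun σ => Om (σ, x₀)) =ᶠ[𝓝 s] fun _ => (0 : E3) := by
      filter_upwards [isOpen_Ioo.mem_nhds hs] with σ hσ using hOm0 σ hσ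
    show deriv (fun σ => Om (σ, x₀)) s = 0
    rw [hev.deriv_eq, deriv_const]
  -- slices are differentiable
  have hslx : ∀ s ∈ Ioo t₀ 0, ∀ y : E3, DifferentiableAt ℝ (fun z => Om₁ (s, z)) y := by
    intro s hs y
    have hq : ((s, y) : ℝ × E3) ∈ W := ⟨hs, mem_univ _⟩
    have hd : DifferentiableAt ℝ Om₁ (s, y) := (hOm₁.differentiableOn (by simp) _ hq).differentiableAt (hW.mem_nhds hq)
    have e : (fun z : E3 => Om₁ (s, z)) = Om₁ ∘ fun z => (s, z) := rfl
    rw [e]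
    exact hd.comp y ((differentiableAt_const s).prodMk differentiableAt_id)
  have hslt : ∀ y : E3, ∀ s ∈ Ioo t₀ 0, HasDerivAt (fun σ => Om (σ, y)) (Om₁ (s, y)) s := by
    intro y s hs
    have hq : ((s, y) : ℝ × E3) ∈ W := ⟨hs, mem_univ _⟩
    have hd : DifferentiableAt ℝ Om (s, y) := (hOm.differentiableOn (by simp) _ hq).differentiableAt (hW.mem_nhds hq)
    have e : (fun σ : ℝ => Om (σ, y)) = Om ∘ fun σ => (σ, y) := rfl
    have h1 : DifferentiableAt ℝ (fun σ : ℝ => Om (σ, y)) s := by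
      rw [e]
      exact hd.comp s (differentiableAt_id.prodMk (differentiableAt_const y))
    exact h1.hasDerivAt
  -- mean value in `x`: `‖Om₁(s, y)‖ ≤ M ‖y − x₀‖`
  have hb₁ : ∀ s ∈ Icc t₁ t₂, ∀ y ∈ Metric.closedBall x₀ 1, ‖Om₁ (s, y)‖ ≤ M * ‖y - x₀‖ := by
    intro s hs y hy
    have hsI : s ∈ Ioo t₀ 0 := hIcc hs
    have hbd : ∀ z ∈ Metric.closedBall x₀ 1, ‖fderiv ℝ (fun w => Om₁ (s, w)) z‖ ≤ M := fun z hz =>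
      (hM₀ (s, z) ⟨hs, hz⟩).trans (le_max_left M₀ 0)
    have h := (convex_closedBall x₀ 1).norm_image_sub_le_of_norm_fderiv_le (f := fun z => Om₁ (s, z))
      (fun z _ => hslx s hsI z) hbd (Metric.mem_closedBall_self zero_le_one) hy
    rw [hOm₁0 s hsI, sub_zero] at h
    exact h
  -- mean value in `t`
  refine ⟨M, hM0, fun t ht t' ht' y hy => ?_⟩
  have h := (convex_Icc t₁ t₂).norm_image_sub_le_of_norm_hasDerivWithin_le
    (f := fun σ => Om (σ, y)) (f' := fun σ => Om₁ (σ, y))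
    (fun σ hσ => (hslt y σ (hIcc hσ)).hasDerivWithinAt) (fun σ hσ => hb₁ σ hσ y hy) ht' ht
  rw [Real.norm_eq_abs] at h
  exact h

/-! ### Assembly: `NetFlux.NearCentreFlux` -/

/-- **`NetFlux.NearCentreFlux` (LINE v5 «netflux-typei-gap», NF-6), proved** — verbatim body of the line's `def NearCentreFlux : Prop`
(Lines file §0 (NC)): near-centre kinematics of the net flux density of a toroidal representation, `κ = π(2L + M)`.  The line's
`stub_nearCentreFlux : NearCentreFlux` is closed by this theorem (definitional unfolding).  No NS statement is involved. [folklore] -/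
theorem nearCentreFlux :
    ∀ (v : ℝ → E3 → E3) (x₀ : E3) (T : ℝ → E3 → ℝ) (t₀ t₁ t₂ : ℝ), t₀ < t₁ → t₁ ≤ t₂ → t₂ < 0 →
      ContDiffOn ℝ (⊤ : ℕ∞) (uncurry v) (Ioo t₀ 0 ×ˢ univ) →
      ContDiffOn ℝ (⊤ : ℕ∞) (uncurry T) (Ioo t₀ 0 ×ˢ ({x₀}ᶜ : Set E3)) →
      (∀ t ∈ Ioo t₀ 0, ∀ x, curl (v t) x = cross (gradient (T t) x) (x - x₀)) →
      ∃ κ : ℝ, 0 ≤ κ ∧ ∀ a₀ : ℝ, 0 < a₀ → a₀ ≤ 1 →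
        (∀ t ∈ Icc t₁ t₂,
          (∀ a ∈ Ioo 0 a₀, netFlux (T t) x₀ a ≤ κ * a ^ 2) ∧
          LipschitzOnWith (Real.toNNReal (κ * a₀)) (fun r => netFlux (T t) x₀ r) (Ioo 0 a₀)) ∧
        (∀ t ∈ Icc t₁ t₂, ∀ t' ∈ Icc t₁ t₂, ∀ a ∈ Ioo 0 a₀,
          |netFlux (T t) x₀ a - netFlux (T t') x₀ a| ≤ κ * a ^ 2 * |t - t'|) := by
  intro v x₀ T t₀ t₁ t₂ h01 _ h20 hv hT hrep
  obtain ⟨L, hL0, hL⟩ := exists_bound_fderiv_curl x₀ hv h01 h20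
  obtain ⟨M, hM0, hM⟩ := exists_bound_curl_sub_curl hv hrep h01 h20
  have hIcc : Icc t₁ t₂ ⊆ Ioo t₀ 0 := fun s hs => ⟨h01.trans_le hs.1, lt_of_le_of_lt hs.2 h20⟩
  have h2top : (2 : WithTop ℕ∞) ≤ ((⊤ : ℕ∞) : WithTop ℕ∞) := WithTop.coe_le_coe.2 le_top
  have h1top : (1 : WithTop ℕ∞) ≤ ((⊤ : ℕ∞) : WithTop ℕ∞) := WithTop.coe_le_coe.2 le_top
  -- per-time data
  have hvt : ∀ t ∈ Ioo t₀ 0, ContDiff ℝ 2 (v t) := fun t ht => (contDiff_slice_of_window hv ht).of_le h2top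
  have hTt : ∀ t ∈ Ioo t₀ 0, ContDiffOn ℝ 1 (T t) ({x₀}ᶜ) := fun t ht => (contDiffOn_slice_compl hT ht).of_le h1top
  have hLt : ∀ t ∈ Icc t₁ t₂, ∀ {b : ℝ}, b ≤ 1 → ∀ x ∈ Metric.closedBall x₀ b, ‖fderiv ℝ (curl (v t)) x‖ ≤ L :=
    fun t ht b hb x hx => hL t ht x (Metric.closedBall_subset_closedBall hb hx)
  have hπ : 0 ≤ Real.pi := Real.pi_pos.le
  refine ⟨Real.pi * (2 * L + M), by positivity, fun a₀ ha₀ ha₀1 => ⟨fun t ht => ⟨fun a ha => ?_, ?_⟩, ?_⟩⟩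
  · -- (a) the growth cap
    have h := netFlux_le_sq (v t) x₀ (T t) ha.1 (hvt t (hIcc ht)) (hTt t (hIcc ht)) (hrep t (hIcc ht))
      (hLt t ht (ha.2.le.trans ha₀1))
    have h2 : Real.pi * L * a ^ 2 ≤ Real.pi * (2 * L + M) * a ^ 2 := by gcongr; linarith
    exact h.trans h2
  · -- (b) Lipschitz in the radius
    have hκ : 0 ≤ Real.pi * (2 * L + M) * a₀ := by positivity
    refine LipschitzOnWith.of_dist_le_mul fun r hr r' hr' => ?_
    rw [Real.coe_toNNReal _ hκ, Real.dist_eq, Real.dist_eq]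
    have htI := hIcc ht
    have hr0 : 0 < r := hr.1
    have hr'0 : 0 < r' := hr'.1
    have hr1 : r ≤ 1 := hr.2.le.trans ha₀1
    have hr'1 : r' ≤ 1 := hr'.2.le.trans ha₀1
    have hosc0 : 0 ≤ sphOsc (T t) x₀ r :=
      sphOsc_nonneg_of_continuousOn (continuousOn_sphere_of_continuousOn_compl (hTt t htI).continuousOn hr.1) hr.1.le
    have hoscle : sphOsc (T t) x₀ r ≤ Real.pi * L * r :=
      sphOsc_le_of_fderiv_curl_le (v t) x₀ (T t) hr.1 (hvt t htI) (hTt t htI) (hrep t htI) (hLt t ht hr1)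
    have hlip : |sphOsc (T t) x₀ r - sphOsc (T t) x₀ r'| ≤ Real.pi * L * |r - r'| :=
      abs_sphOsc_sub_sphOsc_le_radius (hvt t htI) (hTt t htI) (hrep t htI) (hL t ht) hr.1 hr1 hr'.1 hr'1
    unfold netFlux
    have e : r * sphOsc (T t) x₀ r - r' * sphOsc (T t) x₀ r'
        = (r - r') * sphOsc (T t) x₀ r + r' * (sphOsc (T t) x₀ r - sphOsc (T t) x₀ r') := by ring
    rw [e]
    have A : |r - r'| * (Real.pi * L * r) ≤ |r - r'| * (Real.pi * L * a₀) :=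
      mul_le_mul_of_nonneg_left (mul_le_mul_of_nonneg_left hr.2.le (by positivity)) (abs_nonneg _)
    have B : r' * (Real.pi * L * |r - r'|) ≤ a₀ * (Real.pi * L * |r - r'|) :=
      mul_le_mul_of_nonneg_right hr'.2.le (by positivity)
    have C : 0 ≤ Real.pi * M * a₀ * |r - r'| := by positivity
    have key : Real.pi * (2 * L + M) * a₀ * |r - r'|
        = |r - r'| * (Real.pi * L * a₀) + a₀ * (Real.pi * L * |r - r'|) + Real.pi * M * a₀ * |r - r'| := by ring
    calc |(r - r') * sphOsc (T t) x₀ r + r' * (sphOsc (T t) x₀ r - sphOsc (T t) x₀ r')|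
        ≤ |(r - r') * sphOsc (T t) x₀ r| + |r' * (sphOsc (T t) x₀ r - sphOsc (T t) x₀ r')| := abs_add_le _ _
      _ = |r - r'| * sphOsc (T t) x₀ r + r' * |sphOsc (T t) x₀ r - sphOsc (T t) x₀ r'| := by
          rw [abs_mul, abs_mul, abs_of_nonneg hosc0, abs_of_pos hr'.1]
      _ ≤ |r - r'| * (Real.pi * L * r) + r' * (Real.pi * L * |r - r'|) := by
          gcongr
      _ ≤ Real.pi * (2 * L + M) * a₀ * |r - r'| := by linarith [A, B, C, key]
  · -- (c) Lipschitz in time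
    intro t ht t' ht' a ha
    have htI := hIcc ht
    have ht'I := hIcc ht'
    have ha1 : a ≤ 1 := ha.2.le.trans ha₀1
    have hK : ∀ x ∈ Metric.sphere x₀ a, ‖curl (v t) x - curl (v t') x‖ ≤ M * a * |t - t'| := by
      intro x hx
      have hxB : x ∈ Metric.closedBall x₀ 1 := Metric.closedBall_subset_closedBall ha1 (Metric.sphere_subset_closedBall hx)
      have h := hM t ht t' ht' x hxB
      rwa [mem_sphere_iff_norm.1 hx] at h
    have hcmp := abs_sphOsc_sub_sphOsc_le_of_norm_curl_sub_le ha.1 (hTt t htI) (hTt t' ht'I) (hrep t htI) (hrep t' ht'I) hK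
    unfold netFlux
    rw [← mul_sub, abs_mul, abs_of_pos ha.1]
    have ha0 : 0 ≤ a := ha.1.le
    have hA : a * |sphOsc (T t) x₀ a - sphOsc (T t') x₀ a| ≤ a * (Real.pi * (M * a * |t - t'|)) :=
      mul_le_mul_of_nonneg_left hcmp ha0
    have hB : 0 ≤ Real.pi * (2 * L) * a ^ 2 * |t - t'| := by positivity
    have key : Real.pi * (2 * L + M) * a ^ 2 * |t - t'| = a * (Real.pi * (M * a * |t - t'|)) + Real.pi * (2 * L) * a ^ 2 * |t - t'| := by
      ring
    linarith [hA, hB, key]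

end Summit.NavierStokesRegularity.NavierStokesRegularity.Theorems.PoloidalLiouville.NetFlux

end
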